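import Literature.NumberTheory.EllipticCurves.TateCurve.TorsionRootTwo
import Literature.NumberTheory.EllipticCurves.TateCurve.NumberField
import Literature.NumberTheory.DiophantineGeometry.LocalReductionProofs
import HarnessLib

/-!
# The `2l`-th root of the Tate parameter at a place of multiplicative reduction of a number field,
# from the torsion counts alone (number-field corollary of `TorsionRootTwo.lean`; [IUTchI] Ex. 3.2 (iv))

Topic `Literature/NumberTheory/EllipticCurves/TateCurve`, namespace
`Literature.NumberTheory.EllipticCurves.TateCurve`; proof-only (cell abc-iut, seat abc-iut-w5-d047;
classical). The split-free twin of `TorsionRootNumberField.lean`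
(`exists_pow_eq_tateParameter_of_torsion_at`, seat abc-iut-w5-d209, which assumes SPLIT
multiplicative reduction at `v` and uses the `F_v`-isomorphism with the Tate curve): here only
MULTIPLICATIVE reduction at `v` is assumed (the tree's `WeierstrassCurve.HasMultiplicativeReductionAt v`,
i.e. `ord_v(Δ_min) > 0 = ord_v(c₄)` — [IUTchI] Def. 3.1 (b) at `v ∈ V^bad`), which gives `|j(W)|_v > 1`
(Silverman *AEC* VII.5.1 (b), tree `one_lt_norm_j_of_hasMultiplicativeReduction_holds`), hence THE Tate
parameter `q_v ∈ F_v` (ATAEC V.5.3 (a) / Lemma V.5.1: the unique `q` with `0 < |q| < 1`,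
`j(E_q) = j(W)`), and the root is extracted by `TorsionRootTwo.exists_pow_two_mul_eq_tateParameter_of_torsion`
(four `F_v`-points killed by `2` — discriminant parity; `n²` points killed by an odd `n` — Tate's theorem
over `F_v(√γ)` and a norm, `TorsionRootTwist.lean`, seat abc-iut-w5-d181).

* `one_lt_norm_j_of_hasMultiplicativeReductionAt` — `W.HasMultiplicativeReductionAt v ⇒ 1 < ‖j(W)‖_v`
  (in `F_v`);
* `exists_pow_two_mul_eq_of_torsion_at` — `W/F` elliptic, multiplicative at `v`, `n` odd, a `Finset` of
  four `F_v`-points killed by `2` and one of `n²` `F_v`-points killed by `n` ⇒ `∃ q c : F_v`, `q ≠ 0`,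
  `‖q‖ < 1`, `tateJ q = j(W)`, `c^{2n} = q`, `v(j(W)) = (v c)⁻¹^{2n}` (so `2n ∣ ord_v(q_v) = −ord_v(j)`).

Inside the proofs `F_v` is viewed as a `NontriviallyNormedField` through the tree's reducible
`…Ultrametric.AdicCompletion.nontriviallyNormedField` (definitionally the registered norm; no instance
is declared here).

## References
* [SilvermanAEC2009] J. H. Silverman, *The Arithmetic of Elliptic Curves*, 2nd ed., GTM 106 (2009),
  Prop. VII.5.1 (b) (`|j|_v > 1` at multiplicative reduction).
* [SilvermanATAEC1994] J. H. Silverman, *Advanced Topics in the Arithmetic of Elliptic Curves*, GTM 151,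
  Springer 1994, Lemma V.5.1 and Thm. V.5.3 (PDF pp. 406–409), Thm. V.3.1 (b) (PDF pp. 394–396).
* [Mochizuki2012] S. Mochizuki, *Inter-universal Teichmüller theory I*, Def. 3.1 (b)(c), Example 3.2 (iv),
  kurims May-2020 manuscript pp. 61, 71 (consumer only; nothing of it is asserted here).
-/

noncomputable section

open scoped Classical

namespace Literature.NumberTheory.EllipticCurves.TateCurve

open WeierstrassCurve SteinWuthrich2013

section NumberField

open IsDedekindDomain

variable (F : Type) [Field F] [NumberField F] (v : HeightOneSpectrum (NumberField.RingOfIntegers F))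

/-- **`|j(W)|_v > 1` at a place of multiplicative reduction** (Silverman *AEC* Prop. VII.5.1 (b)), read
in the completion `F_v`: for `W/F` elliptic with the tree's `W.HasMultiplicativeReductionAt v` (the chosen
local minimal model `W.localMinimalModel v` over `𝒪_v` has `v(c₄) = 0 < v(Δ)`),
`1 < ‖j(W)‖` in `F_v` — the tree's DISCHARGED local form
`one_lt_norm_j_of_hasMultiplicativeReduction_holds` applied to the local minimal model, whose
`j`-invariant is `j(W)` (`variableChange_j`, `map_j`). [cite: SilvermanAEC2009, Prop. VII.5.1 (b)] -/
theorem one_lt_norm_j_of_hasMultiplicativeReductionAt (W : WeierstrassCurve F) [W.IsElliptic]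
    (hmult : W.HasMultiplicativeReductionAt v) :
    1 < ‖algebraMap F (v.adicCompletion F) W.j‖ := by
  letI := Literature.NumberTheory.GaloisRepresentations.Ultrametric.AdicCompletion.nontriviallyNormedField F v
  haveI := charZero_adicCompletion' F v
  haveI := W.isElliptic_localMinimalModel v
  haveI : (W.baseChange (v.adicCompletion F)).IsElliptic := by
    unfold WeierstrassCurve.baseChange; infer_instance
  -- `j` of the local minimal model is `j(W)` read in `F_v`
  have hjE : (W.localMinimalModel v).j = algebraMap F (v.adicCompletion F) W.j := by
    have hC : ((((W.baseChange (v.adicCompletion F)).exists_isMinimal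
        (v.adicCompletionIntegers F)).choose) • W.baseChange (v.adicCompletion F)).j =
        algebraMap F (v.adicCompletion F) W.j := by
      rw [variableChange_j]; exact W.map_j _
    exact hC
  rw [← hjE]
  exact one_lt_norm_j_of_hasMultiplicativeReduction_holds (v.adicCompletionIntegers F)
    (norm_le_one_iff_mem_range_adicCompletionIntegers F v) (W.localMinimalModel v) hmult

/-- **At a place of MULTIPLICATIVE reduction (split or not), four rational `2`-torsion points and `n²`
rational `n`-torsion points over `F_v`, `n` odd, force `q_v = c^{2n}`** (hence
`2n ∣ ord_v(q_v) = −ord_v(j)`): for `W/F` elliptic with the tree's `W.HasMultiplicativeReductionAt v`,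
a `Finset` of four `F_v`-points of `W` killed by `2` and a `Finset` of `n²` `F_v`-points killed by the
odd `n`, the Tate parameter `q_v ∈ F_v` of Silverman ATAEC V.5.3 (a) (`q_v ≠ 0`, `‖q_v‖ < 1`,
`tateJ q_v = j(W)`) is `c^{2n}` for some `c ∈ F_v`, and `v(j(W)) = (v(c))⁻¹ ^ (2n)`. With `n = l` this
is the `2l`-th root `q̲_v` of [IUTchI] Ex. 3.2 (iv) from Def. 3.1 (b) (`E_F[2] ⊆ E_F(F)`, `E_F`
multiplicative at `v ∈ V^bad`) and (c) (`K := F(E_F[l])`) — with NO splitness hypothesis (split-free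
twin of `exists_pow_eq_tateParameter_of_torsion_at`). [cite: SilvermanATAEC1994, Lemma V.5.1 and Thm. V.5.3 (PDF pp. 406–409)] -/
theorem exists_pow_two_mul_eq_of_torsion_at (W : WeierstrassCurve F) [W.IsElliptic]
    (hmult : W.HasMultiplicativeReductionAt v)
    (S₂ : Finset (W.baseChange (v.adicCompletion F)).toAffine.Point)
    (hS₂ : ∀ P ∈ S₂, (2 : ℕ) • P = 0) (hcard₂ : 4 ≤ S₂.card) {n : ℕ} (hn : Odd n)
    (Sₙ : Finset (W.baseChange (v.adicCompletion F)).toAffine.Point) (hSₙ : ∀ P ∈ Sₙ, n • P = 0)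
    (hcardₙ : n ^ 2 ≤ Sₙ.card) :
    ∃ q c : v.adicCompletion F, q ≠ 0 ∧ ‖q‖ < 1 ∧
      tateJ q = algebraMap F (v.adicCompletion F) W.j ∧ c ^ (2 * n) = q ∧
      Valued.v (algebraMap F (v.adicCompletion F) W.j) = ((Valued.v c)⁻¹) ^ (2 * n) := by
  letI := Literature.NumberTheory.GaloisRepresentations.Ultrametric.AdicCompletion.nontriviallyNormedField F v
  haveI := charZero_adicCompletion' F v
  haveI : (W.baseChange (v.adicCompletion F)).IsElliptic := by
    unfold WeierstrassCurve.baseChange; infer_instance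
  have hjW : (W.baseChange (v.adicCompletion F)).j = algebraMap F (v.adicCompletion F) W.j :=
    W.map_j _
  have hj : 1 < ‖(W.baseChange (v.adicCompletion F)).j‖ := by
    rw [hjW]; exact one_lt_norm_j_of_hasMultiplicativeReductionAt F v W hmult
  obtain ⟨c, hc⟩ := exists_pow_two_mul_eq_tateParameter_of_torsion (W.baseChange (v.adicCompletion F))
    hj S₂ hS₂ hcard₂ hn Sₙ hSₙ hcardₙ
  have hqn : ‖tateParameter (W.baseChange (v.adicCompletion F)) hj‖ =
      ‖algebraMap F (v.adicCompletion F) W.j‖⁻¹ := by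
    rw [← hjW]; exact norm_tateParameter _ hj
  refine ⟨tateParameter (W.baseChange (v.adicCompletion F)) hj, c, tateParameter_ne_zero _ hj,
    norm_tateParameter_lt_one _ hj, by rw [tateJ_tateParameter, hjW], hc, ?_⟩
  rw [← inv_inv (Valued.v (algebraMap F (v.adicCompletion F) W.j)),
    ← valuation_eq_inv_of_norm_eq_inv F v hqn, ← hc, map_pow, inv_pow]

end NumberField

end Literature.NumberTheory.EllipticCurves.TateCurve

end
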